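import Mathlib
import Summits.Ventures.PercRepro2.SwOutMultiRootEIneq
import Summits.Ventures.PercRepro2.SwOutMultiRootSides
import Summits.Ventures.PercRepro2.SwOutMultiRootBase

/-!
# The multi-root core cube with root–root edges: the base of a non-escaping side point and its
cube (blind cell PercRepro2, night-4 g34, 2026-08-29; proofs/NIGHT4-G34.md §8)

The root–root edges `rrEdges` of a root set, the base `baseRR` (the blue part flipped, every
root–root edge red) and the cube point `omegaRR` of a side point (its arm part `omegaR`, its
root–root part the colours of `ζ`).  At a non-escaping side point the base is a multi-root base
with root–root edges (**`multiBaseE_baseRR`**; the fields from SwOutMultiRootSides, which only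
needs «no loop at a root»), the point is the cube point `omegaRR` of its base, and along the cube
the extended hull, the blue part, the base and the arms are constant while every root stays
non-escaping — the key of the block decomposition (SwOutMultiRootEThm).
-/

namespace Summit.Ventures.PercRepro2

namespace LocRows

open Hull

variable {V : Type*} {E : Type*}

open scoped Classical

variable {ends : E → Sym2 V}

section Defs

variable [Fintype E] [DecidableEq E] (ends) (R : Set V) (ζ : Config E)

/-- The edges joining two roots. -/
noncomputable def rrEdges : Finset E :=
  Finset.univ.filter fun e => ∃ r ∈ R, ∃ r' ∈ R, ends e = s(r, r')

/-- The base with root–root edges: the blue part flipped, every root–root edge red. -/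
noncomputable def baseRR : Config E :=
  fun e => if e ∈ rrEdges ends R then true else baseR ends R ζ e

/-- The cube point of a side point: its arms by `omegaR`, its root–root edges by their colours. -/
noncomputable def omegaRR : Config (↥(armsR ends R ζ) ⊕ ↥(rrEdges ends R)) :=
  Sum.elim (omegaR ends R ζ) fun e => ζ e.1

variable {ends R ζ}

omit [DecidableEq E] in
/-- Membership in the root–root edges. -/
lemma mem_rrEdges {e : E} : e ∈ rrEdges ends R ↔ ∃ r ∈ R, ∃ r' ∈ R, ends e = s(r, r') := by
  simp only [rrEdges, Finset.mem_filter, Finset.mem_univ, true_and]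

/-- The base on a root–root edge. -/
lemma baseRR_apply_of_mem {e : E} (he : e ∈ rrEdges ends R) : baseRR ends R ζ e = true := by
  simp only [baseRR, if_pos he]

/-- The base off the root–root edges. -/
lemma baseRR_apply_of_notMem {e : E} (he : e ∉ rrEdges ends R) :
    baseRR ends R ζ e = baseR ends R ζ e := by
  simp only [baseRR, if_neg he]

omit [DecidableEq E] in
/-- An edge with an end outside the roots is not a root–root edge. -/
lemma notMem_rrEdges_of_notMem {e : E} {x y : V} (hxy : ends e = s(x, y)) (hx : x ∉ R) :
    e ∉ rrEdges ends R := by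
  intro he
  obtain ⟨r, hr, r', hr', hrr⟩ := mem_rrEdges.1 he
  rw [hxy, Sym2.eq_iff] at hrr
  rcases hrr with ⟨rfl, -⟩ | ⟨rfl, -⟩
  · exact hx hr
  · exact hx hr'

/-- Inside an arm together with a root, the base with root–root edges is the base (no loop at a
root). -/
lemma insideConfig_baseRR (hloop : ∀ e r, r ∈ R → ends e ≠ s(r, r)) {P : Set V} (hP : P ⊆ Rᶜ)
    {r : V} (hr : r ∈ R) :
    insideConfig ends (P ∪ {r}) (baseRR ends R ζ) = insideConfig ends (P ∪ {r}) (baseR ends R ζ) := by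
  funext e
  simp only [insideConfig]
  by_cases he : e ∈ within ends (P ∪ {r})
  · obtain ⟨x, hx, y, hy, hxy⟩ := he
    rcases hx with hx | hx
    · rw [baseRR_apply_of_notMem (notMem_rrEdges_of_notMem hxy (hP hx))]
    · rcases hy with hy | hy
      · rw [baseRR_apply_of_notMem (notMem_rrEdges_of_notMem (ends_swap hxy) (hP hy))]
      · rw [Set.mem_singleton_iff] at hx hy
        rcases hx with rfl; rcases hy with rfl
        exact absurd hxy (hloop e _ hr)
  · rw [decide_eq_false he, Bool.and_false, Bool.and_false]

end Defs

section NonEscaping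

variable [Fintype E] [DecidableEq E] {U : Set V} {ξ : Config E} {l h : V} {R : Set V}
  {𝓤 𝓓 𝓓'' : Set (Set V)} {X : Set V} {𝓤' : Set (Set V)} {F : V → Prop} {ζ : Config E}
  (hl : l ∉ U) (hloop : ∀ e r, r ∈ R → ends e ≠ s(r, r))
  (hF : ∀ x, F x → ∀ S ∈ 𝓤, x ∈ S)
  (hout : ∀ x ∈ U, x ∉ R →
    F x ∨ x ∈ X ∨ (∃ e y, ends e = s(x, y) ∧ y ∉ U) ∨ (∀ e, x ∉ ends e))
  (hX : ∀ x ∈ X, x ∈ U → ∀ e, x ∈ ends e → ends e = s(x, x))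
  (hζ : ζ ∈ gOutSide ends l h 𝓤 𝓓 𝓓'' X 𝓤' U ξ)
  (hne : ∀ r ∈ R, hull ends ζ r ⊆ U)
include hl hloop hF hout hX hζ hne

/-- **The base of a non-escaping side point is a multi-root base with root–root edges** on the
extended hull with the arms `armsR`. -/
theorem multiBaseE_baseRR :
    MultiBaseE ends (baseRR ends R ζ) R (extHullR ends R ζ) (armsFun (armsR ends R ζ))
      (rrEdges ends R) where
  root_sub := fun r hr => mem_extHullR_of_mem hr
  bdry_blue := by
    intro e x y hxy hxH hyH
    by_cases hxR : x ∈ R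
    · exact absurd ⟨x, hxR, mem_hull_of_adj_root hxy⟩ hyH
    rw [baseRR_apply_of_notMem (notMem_rrEdges_of_notMem hxy hxR)]
    rcases mem_redPartR_or_bluePartR hxH hxR with hx | hx
    · rw [baseR_apply_of_red hl hF hout hX hζ hne hxy hx]
      obtain ⟨⟨r, hr, hxr⟩, -⟩ := hx
      cases he : ζ e with
      | true => exact absurd ⟨r, hr, Or.inl (mem_cluster_of_edge hxr he hxy)⟩ hyH
      | false => rfl
    · rw [baseR_apply_of_blue hxy hx]
      obtain ⟨⟨r, hr, hxr⟩, -⟩ := hx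
      cases he : ζ e with
      | true => rfl
      | false =>
        exfalso
        have he' : blue ζ e = true := by rw [blue_eq_true_iff]; exact he
        exact hyH ⟨r, hr, Or.inr (mem_cluster_of_edge hxr he' hxy)⟩
  arm_sub := by
    intro P x hx
    obtain ⟨y, hyH, hyR, hP⟩ := exists_of_mem_armsR P.2
    change x ∈ P.1 at hx
    rw [hP] at hx
    exact armR_subset hyH hyR hx
  arm_nonempty := by
    intro P
    obtain ⟨y, -, -, hP⟩ := exists_of_mem_armsR P.2
    refine ⟨y, ?_⟩
    change y ∈ P.1
    rw [hP]; exact mem_armR_self y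
  arm_disj := by
    intro P Q hPQ x hxP hxQ
    obtain ⟨y, -, -, hP⟩ := exists_of_mem_armsR P.2
    obtain ⟨z, -, -, hQ⟩ := exists_of_mem_armsR Q.2
    change x ∈ P.1 at hxP
    change x ∈ Q.1 at hxQ
    apply hPQ
    apply Subtype.ext
    rw [hP] at hxP
    rw [hQ] at hxQ
    rw [hP, hQ]
    exact armR_eq_armR_of_mem_of_mem hxP hxQ
  arm_cover := fun x hx hxR =>
    ⟨⟨armR ends R ζ x, armR_mem_armsR_of_mem_extHullR hx hxR⟩, mem_armR_self x⟩
  no_cross := by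
    intro P Q hPQ e x y hxy hxP hyQ
    obtain ⟨p, hpH, hpR, hP⟩ := exists_of_mem_armsR P.2
    obtain ⟨q, hqH, hqR, hQ⟩ := exists_of_mem_armsR Q.2
    change x ∈ P.1 at hxP
    change y ∈ Q.1 at hyQ
    rw [hP] at hxP
    rw [hQ] at hyQ
    have hxH := armR_subset hpH hpR hxP
    have hyH := armR_subset hqH hqR hyQ
    have h1 := armR_eq_of_edge hxy hxH hyH
    apply hPQ
    apply Subtype.ext
    rw [hP, hQ, ← armR_eq_of_mem hxP, ← armR_eq_of_mem hyQ, h1]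
  root_edges := by
    intro e r x hr hrx
    by_cases hxR : x ∈ R
    · exact Or.inl hxR
    · exact Or.inr ⟨⟨armR ends R ζ x, armR_mem_armsR hr hrx hxR⟩, mem_armR_self x⟩
  loop_root := hloop
  root_red := by
    intro e r x hr hrx
    by_cases hxR : x ∈ R
    · exact baseRR_apply_of_mem (mem_rrEdges.2 ⟨r, hr, x, hxR, hrx⟩)
    rw [baseRR_apply_of_notMem (notMem_rrEdges_of_notMem (ends_swap hrx) hxR)]
    have hxH : x ∈ extHullR ends R ζ := ⟨r, hr, mem_hull_of_adj_root hrx⟩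
    rcases mem_redPartR_or_bluePartR hxH hxR with hx | hx
    · rw [baseR_apply_of_red hl hF hout hX hζ hne (ends_swap hrx) hx]
      cases he : ζ e with
      | true => rfl
      | false =>
        exfalso
        have he' : blue ζ e = true := by rw [blue_eq_true_iff]; exact he
        exact redPartR_disjoint_bluePartR hl hF hout hX hζ hne hx
          ⟨⟨r, hr, mem_cluster_of_edge (mem_cluster_self _ _ _) he' hrx⟩, hxR⟩
    · rw [baseR_apply_of_blue (ends_swap hrx) hx]
      cases he : ζ e with
      | true =>
        exfalso
        exact redPartR_disjoint_bluePartR hl hF hout hX hζ hne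
          ⟨⟨r, hr, mem_cluster_of_edge (mem_cluster_self _ _ _) he hrx⟩, hxR⟩ hx
      | false => rfl
  rr_iff := fun e => mem_rrEdges
  conn := by
    intro P x hx
    obtain ⟨y, hyH, hyR, hP⟩ := exists_of_mem_armsR P.2
    change x ∈ P.1 at hx
    have hP' : armsFun (armsR ends R ζ) P = P.1 := rfl
    rw [hP']
    rw [hP] at hx ⊢
    have hxH := armR_subset hyH hyR hx
    have harm : armR ends R ζ x = armR ends R ζ y := armR_eq_of_mem hx
    have hPR : armR ends R ζ y ⊆ Rᶜ := fun z hz => (armR_subset hyH hyR hz).2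
    rcases mem_redPartR_or_bluePartR hxH.1 hxH.2 with hxr | hxr
    · obtain ⟨r, hr, hc⟩ := exists_root_conn_inside_red hxr
      refine ⟨r, hr, ?_⟩
      rw [harm] at hc
      have hsub : armR ends R ζ y ⊆ redPartR ends R ζ := by
        rw [← harm]; exact armR_subset_redPartR hl hF hout hX hζ hne hxr
      rw [insideConfig_baseRR hloop hPR hr, insideConfig_baseR_of_red hl hloop hF hout hX hζ hne hsub hr]
      exact hc
    · obtain ⟨r, hr, hc⟩ := exists_root_conn_inside_blue hxr
      refine ⟨r, hr, ?_⟩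
      rw [harm] at hc
      have hsub : armR ends R ζ y ⊆ bluePartR ends R ζ := by
        rw [← harm]; exact armR_subset_bluePartR hl hF hout hX hζ hne hxr
      rw [insideConfig_baseRR hloop hPR hr, insideConfig_baseR_of_blue hloop hsub hr]
      exact hc

omit hloop in
/-- **The side point is the cube point `omegaRR` of its base.** -/
theorem coreRealRR_baseRR_omegaRR :
    coreRealRR ends (armsFun (armsR ends R ζ)) (rrEdges ends R) (baseRR ends R ζ) (omegaRR ends R ζ) =
      ζ := by
  funext e
  by_cases he : e ∈ rrEdges ends R
  · rw [coreRealRR_apply_rr he, baseRR_apply_of_mem he]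
    simp only [omegaRR, Sum.elim_inr]
    by_cases hz : ζ e = true
    · rw [if_pos hz, hz]
    · rw [if_neg hz, Bool.not_true]
      exact (Bool.eq_false_iff.mpr hz).symm
  · rw [coreRealRR_apply_of_notMem_rr he]
    have h1 : (fun i => omegaRR ends R ζ (Sum.inl i)) = omegaR ends R ζ := by
      funext i; simp [omegaRR]
    rw [h1]
    unfold coreReal
    rw [armsFalseC_omegaR hl hF hout hX hζ hne]
    have h2 : ∀ P : Set V, Hull.flip ends P (baseRR ends R ζ) e = Hull.flip ends P (baseR ends R ζ) e := by
      intro P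
      by_cases ht : e ∈ touches ends P
      · rw [flip_apply_of_mem ht, flip_apply_of_mem ht, baseRR_apply_of_notMem he]
      · rw [flip_apply_of_notMem ht, flip_apply_of_notMem ht, baseRR_apply_of_notMem he]
    rw [h2, baseR, Hull.flip_flip]

end NonEscaping

section CubePoints

variable [Fintype E] [DecidableEq E] {ι : Type*} {A : ι → Set V} {b : Config E} {R H : Set V}
  {RR : Finset E} (hb : MultiBaseE ends b R H A RR)
include hb

omit [Fintype E] [DecidableEq E] in
/-- At a cube point with `A i` red, the red edges of the base inside `A i ∪ {r}` are red. -/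
lemma MultiBaseE.insideConfig_le_coreRealRR {ω : Config (ι ⊕ ↥RR)} {i : ι}
    (hi : ω (Sum.inl i) = true) {r : V} (hr : r ∈ R) :
    insideConfig ends (A i ∪ {r}) b ≤ coreRealRR ends A RR b ω := by
  intro e
  by_cases he : insideConfig ends (A i ∪ {r}) b e = true
  · rw [he]
    obtain ⟨hbe, x, hx, y, hy, hxy⟩ := insideConfig_eq_true_iff.1 he
    rcases hx with hx | hx
    · rw [hb.coreRealRR_apply_of_mem hxy hx, if_pos hi, hbe]
    · rcases hy with hy | hy
      · rw [hb.coreRealRR_apply_of_mem (ends_swap hxy) hy, if_pos hi, hbe]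
      · rw [Set.mem_singleton_iff] at hx hy
        rcases hx with rfl; rcases hy with rfl
        exact absurd hxy (hb.loop_root e _ hr)
  · simp only [Bool.not_eq_true] at he
    rw [he]; exact Bool.false_le _

omit [Fintype E] [DecidableEq E] in
/-- At a cube point with `A i` blue, the red edges of the base inside `A i ∪ {r}` are blue. -/
lemma MultiBaseE.insideConfig_le_blue_coreRealRR {ω : Config (ι ⊕ ↥RR)} {i : ι}
    (hi : ω (Sum.inl i) = false) {r : V} (hr : r ∈ R) :
    insideConfig ends (A i ∪ {r}) b ≤ blue (coreRealRR ends A RR b ω) := by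
  intro e
  by_cases he : insideConfig ends (A i ∪ {r}) b e = true
  · rw [he]
    obtain ⟨hbe, x, hx, y, hy, hxy⟩ := insideConfig_eq_true_iff.1 he
    have hi' : ω (Sum.inl i) ≠ true := by rw [hi]; decide
    rcases hx with hx | hx
    · rw [blue_apply, hb.coreRealRR_apply_of_mem hxy hx, if_neg hi', hbe]; rfl
    · rcases hy with hy | hy
      · rw [blue_apply, hb.coreRealRR_apply_of_mem (ends_swap hxy) hy, if_neg hi', hbe]; rfl
      · rw [Set.mem_singleton_iff] at hx hy
        rcases hx with rfl; rcases hy with rfl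
        exact absurd hxy (hb.loop_root e _ hr)
  · simp only [Bool.not_eq_true] at he
    rw [he]; exact Bool.false_le _

omit [Fintype E] [DecidableEq E] in
/-- Every vertex of `H` lies in the hull of some root at every cube point. -/
theorem MultiBaseE.mem_extHullR_coreRealRR (ω : Config (ι ⊕ ↥RR)) {x : V} (hx : x ∈ H) :
    x ∈ extHullR ends R (coreRealRR ends A RR b ω) := by
  by_cases hxR : x ∈ R
  · exact mem_extHullR_of_mem hxR
  obtain ⟨i, hi⟩ := hb.arm_cover x hx hxR
  obtain ⟨r, hr, hc⟩ := hb.conn i x hi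
  refine ⟨r, hr, ?_⟩
  cases hωi : ω (Sum.inl i) with
  | true => exact Or.inl (cluster_mono (hb.insideConfig_le_coreRealRR hωi hr) r hc)
  | false => exact Or.inr (cluster_mono (hb.insideConfig_le_blue_coreRealRR hωi hr) r hc)

omit [Fintype E] [DecidableEq E] in
/-- **The extended hull is constant along the cube.** -/
theorem MultiBaseE.extHullR_coreRealRR (ω : Config (ι ⊕ ↥RR)) :
    extHullR ends R (coreRealRR ends A RR b ω) = H := by
  apply Set.Subset.antisymm
  · rintro x ⟨r, hr, hx⟩
    exact hb.hull_subset ω hr hx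
  · intro x hx
    exact hb.mem_extHullR_coreRealRR ω hx

omit [Fintype E] [DecidableEq E] in
/-- **The blue part of a cube point is the union of its `false` arms.** -/
theorem MultiBaseE.bluePartR_coreRealRR (ω : Config (ι ⊕ ↥RR)) :
    bluePartR ends R (coreRealRR ends A RR b ω) = armsFalseC A (armPart ω) := by
  ext x
  constructor
  · rintro ⟨⟨r, hr, hx⟩, hxR⟩
    rcases hb.mem_root_or_false_of_mem_cluster_blue ω hr hx with h' | ⟨i, hi, hxi⟩
    · exact absurd h' hxR
    · exact ⟨i, hi, hxi⟩
  · rintro ⟨i, hi, hxi⟩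
    obtain ⟨r, hr, hc⟩ := hb.conn i x hxi
    exact ⟨⟨r, hr, cluster_mono (hb.insideConfig_le_blue_coreRealRR hi hr) r hc⟩,
      (hb.arm_sub i x hxi).2⟩

/-- **The base is constant along the cube.** -/
theorem MultiBaseE.baseRR_coreRealRR (hRR : RR = rrEdges ends R) (ω : Config (ι ⊕ ↥RR)) :
    baseRR ends R (coreRealRR ends A RR b ω) = b := by
  funext e
  by_cases he : e ∈ rrEdges ends R
  · rw [baseRR_apply_of_mem he]
    obtain ⟨r, hr, r', -, hrr⟩ := mem_rrEdges.1 he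
    exact (hb.root_red e r r' hr hrr).symm
  · rw [baseRR_apply_of_notMem he]
    unfold baseR
    rw [hb.bluePartR_coreRealRR ω]
    have he' : e ∉ RR := by rw [hRR]; exact he
    have h1 : coreRealRR ends A RR b ω e = Hull.flip ends (armsFalseC A (armPart ω)) b e := by
      rw [coreRealRR_apply_of_notMem_rr he']; rfl
    have h2 : ∀ ζ₁ ζ₂ : Config E, ζ₁ e = ζ₂ e →
        Hull.flip ends (armsFalseC A (armPart ω)) ζ₁ e =
          Hull.flip ends (armsFalseC A (armPart ω)) ζ₂ e := by
      intro ζ₁ ζ₂ h'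
      by_cases ht : e ∈ touches ends (armsFalseC A (armPart ω))
      · rw [flip_apply_of_mem ht, flip_apply_of_mem ht, h']
      · rw [flip_apply_of_notMem ht, flip_apply_of_notMem ht, h']
    rw [h2 _ _ h1, Hull.flip_flip]

/-- **The arms are constant along the cube.** -/
theorem MultiBaseE.armsR_coreRealRR (ω : Config (ι ⊕ ↥RR)) (hH : extHullR ends R b = H) :
    armsR ends R (coreRealRR ends A RR b ω) = armsR ends R b := by
  apply armsR_congr
  rw [hb.extHullR_coreRealRR ω, hH]

omit [Fintype E] [DecidableEq E] in
/-- Every root is non-escaping at every cube point (`H ⊆ U`). -/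
theorem MultiBaseE.hull_coreRealRR_subset_U {U : Set V} (hHU : H ⊆ U) (ω : Config (ι ⊕ ↥RR))
    {r : V} (hr : r ∈ R) : hull ends (coreRealRR ends A RR b ω) r ⊆ U :=
  (hb.hull_subset ω hr).trans hHU

omit [Fintype E] [DecidableEq E] hb in
/-- The base itself is the cube point `⊤`. -/
lemma MultiBaseE.coreRealRR_top : coreRealRR ends A RR b (fun _ => true) = b := by
  funext e
  by_cases he : e ∈ RR
  · rw [coreRealRR_apply_rr he, if_pos rfl]
  · rw [coreRealRR_apply_of_notMem_rr he]
    unfold coreReal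
    have : armsFalseC A (fun _ => true) = ∅ := by
      ext x; simp [armsFalseC]
    rw [this, flip_apply_of_notMem]
    rintro ⟨x, hx, -⟩
    exact hx

end CubePoints

end LocRows

end Summit.Ventures.PercRepro2
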